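import Mathlib.Logic.Equiv.Fin.Basic
import Literature.Computability.Complexity.AOWProductLaw
import Literature.Computability.Complexity.AOWTraceWalks
import Literature.Computability.Complexity.AOWWalkCounting
import HarnessLib

/-!
# The moment bound `E tr((BᵀB)^q)` for random signed fiber matrices
(the trace method for the level matrices; Allen–O'Donnell–Witmer 2015, App. A.1/A.4)

Trunk T-CPLX-CORE (Literature/Computability/Complexity). Support file for the discharge of the
named fact `allen_odonnell_witmer_kSAT` (`AOWRefutation.lean`), probabilistic part IV.

Let `T ∼ subsetPMF Λ p` (each label present independently with probability `p`) and let
`B_T = fiberMatrix row col (ℓ ↦ ε_ℓ (1[ℓ ∈ T] - p))` be the random `U × V` matrix whose `(u,v)`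
entry is the signed, centred count of present labels over `(u,v)` (`|ε| ≤ 1`). If every label
shares its row with at most `D` labels and its column with at most `D` labels, then for every
`q = n + 1 ≥ 1` (`randFiberMatrix`, `subsetExp_trace_pow_randFiberMatrix_le`)

  `E tr((B_TᵀB_T)^q) ≤ |Λ| · (2q)^{2q-1} · p · q · max(1, (pD)^{q-1})`.

Proof = label expansion (`AOWTraceWalks`) + `E[∏ (ξ - p)]` vanishes on singletons and is
`≤ p^{#distinct}` otherwise (`AOWProductLaw`) + counting of adjacency-constrained sequences
(`AOWWalkCounting`), exactly the scheme of AOW App. A.4 (there for the odd matrix `A`); this is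
the even/rectangular case ("Proposition A.? via [Tao12]" in AOW App. A.1, which we replace by the
trace method so that the certificate is an integer trace).

## References

* S. R. Allen, R. O'Donnell, D. Witmer, *How to refute a random CSP*, FOCS 2015,
  arXiv:1505.04383, App. A.1 (even arity, norm of the random matrix `B`), App. A.4 (trace
  method: expansion, `E[P_{J,L}] ≤ p^{#distinct}`, vanishing, counting).
* Z. Füredi, J. Komlós, *The eigenvalues of random symmetric matrices*, Combinatorica 1 (1981), §3.
-/

noncomputable section

namespace Literature.Computability.Complexity

open Finset Matrix

variable {U V Λ : Type} [Fintype U] [Fintype V] [Fintype Λ]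
variable [DecidableEq U] [DecidableEq V] [DecidableEq Λ]

/-! ### Interleaving a pair of label sequences -/

/-- The interleaved sequence `L₀, L'₀, L₁, L'₁, …` of a pair of label sequences, as a function on
`Fin ((n+1)·2)` through `finProdFinEquiv`. [folklore] -/
def pairSeq {n : ℕ} (L L' : Fin (n + 1) → Λ) : Fin ((n + 1) * 2) → Λ :=
  fun t => if (finProdFinEquiv.symm t).2 = 0 then L (finProdFinEquiv.symm t).1
    else L' (finProdFinEquiv.symm t).1

omit [Fintype Λ] [DecidableEq Λ] in
/-- Even positions carry `L`. [folklore] -/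
@[simp] theorem pairSeq_apply_zero {n : ℕ} (L L' : Fin (n + 1) → Λ) (j : Fin (n + 1)) :
    pairSeq L L' (finProdFinEquiv (j, (0 : Fin 2))) = L j := by
  simp [pairSeq]

omit [Fintype Λ] [DecidableEq Λ] in
/-- Odd positions carry `L'`. [folklore] -/
@[simp] theorem pairSeq_apply_one {n : ℕ} (L L' : Fin (n + 1) → Λ) (j : Fin (n + 1)) :
    pairSeq L L' (finProdFinEquiv (j, (1 : Fin 2))) = L' j := by
  simp [pairSeq]

omit [Fintype Λ] [DecidableEq Λ] in
/-- A product over the interleaved sequence splits into the two sequences. [folklore] -/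
theorem prod_pairSeq {n : ℕ} (L L' : Fin (n + 1) → Λ) (h : Λ → ℝ) :
    ∏ t, h (pairSeq L L' t) = ∏ j, h (L j) * h (L' j) := by
  rw [← Equiv.prod_comp finProdFinEquiv (fun t => h (pairSeq L L' t)), Fintype.prod_prod_type]
  refine Finset.prod_congr rfl fun j _ => ?_
  rw [Fin.prod_univ_two, pairSeq_apply_zero, pairSeq_apply_one]

omit [Fintype Λ] [DecidableEq Λ] in
/-- Interleaving is injective. [folklore] -/
theorem pairSeq_injective {n : ℕ} :
    Function.Injective (fun LL : (Fin (n + 1) → Λ) × (Fin (n + 1) → Λ) => pairSeq LL.1 LL.2) := by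
  rintro ⟨L₁, L₁'⟩ ⟨L₂, L₂'⟩ h
  simp only at h
  refine Prod.ext (funext fun j => ?_) (funext fun j => ?_)
  · have := congr_fun h (finProdFinEquiv (j, (0 : Fin 2)))
    rwa [pairSeq_apply_zero, pairSeq_apply_zero] at this
  · have := congr_fun h (finProdFinEquiv (j, (1 : Fin 2)))
    rwa [pairSeq_apply_one, pairSeq_apply_one] at this

/-- The walk adjacency of interleaved sequences: consecutive labels share a row (even step) or
a column (odd step). [Allen–O'Donnell–Witmer 2015, App. A.4] [folklore] -/
def walkAdj (row : Λ → U) (col : Λ → V) (t : ℕ) (a b : Λ) : Prop :=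
  if t % 2 = 0 then row b = row a else col b = col a

/-- `walkAdj` is decidable. [folklore] -/
instance instDecidableWalkAdj (row : Λ → U) (col : Λ → V) (t : ℕ) (a b : Λ) :
    Decidable (walkAdj row col t a b) := by
  unfold walkAdj
  infer_instance

omit [DecidableEq Λ] [Fintype U] [Fintype V] in
/-- The neighbour bound for `walkAdj`: at most `D` labels are adjacent to a given one, if rows and
columns contain at most `D` labels each. [folklore] -/
theorem card_filter_walkAdj_le (row : Λ → U) (col : Λ → V) {D : ℕ}
    (hrow : ∀ l, (univ.filter fun l' => row l' = row l).card ≤ D)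
    (hcol : ∀ l, (univ.filter fun l' => col l' = col l).card ≤ D) (t : ℕ) (a : Λ) :
    (univ.filter (walkAdj row col t a)).card ≤ D := by
  unfold walkAdj
  split_ifs
  · exact hrow a
  · exact hcol a

omit [Fintype Λ] [DecidableEq Λ] [Fintype U] [Fintype V] [DecidableEq U] [DecidableEq V] in
/-- An admissible pair interleaves to an adjacency-constrained sequence (the wrap-around
condition is dropped). [Allen–O'Donnell–Witmer 2015, App. A.4] [folklore] -/
theorem isAdjSeq_pairSeq (row : Λ → U) (col : Λ → V) {n : ℕ} {L L' : Fin (n + 1) → Λ}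
    (h : IsAdmissible row col L L') : IsAdjSeq (walkAdj row col) (pairSeq L L') := by
  intro t s hs
  obtain ⟨⟨j, y⟩, rfl⟩ := finProdFinEquiv.surjective t
  have hval : ∀ (j' : Fin (n + 1)) (y' : Fin 2),
      ((finProdFinEquiv (j', y') : Fin ((n + 1) * 2)) : ℕ) = y' + 2 * j' := fun j' y' => by simp
  have hy : y = 0 ∨ y = 1 := by
    match y with
    | 0 => exact Or.inl rfl
    | 1 => exact Or.inr rfl
  rcases hy with rfl | rfl
  · -- even position `2j`: next is `L' j`, same row
    have hs' : s = finProdFinEquiv (j, (1 : Fin 2)) := by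
      apply Fin.ext
      rw [hval] at hs ⊢
      simp only [Fin.isValue, Fin.val_zero, zero_add, Fin.val_one] at hs ⊢
      omega
    subst hs'
    have heven : ((0 : Fin 2) : ℕ) + 2 * (j : ℕ) = 2 * j := by simp
    simp only [walkAdj, hval, heven, Nat.mul_mod_right, if_true, pairSeq_apply_zero,
      pairSeq_apply_one]
    exact (h j).1
  · -- odd position `2j+1`: next is `L (j+1)`, same column
    have hj : (j : ℕ) + 1 < n + 1 := by
      have := s.isLt
      rw [hval] at hs
      simp only [Fin.isValue, Fin.val_one] at hs
      omega
    have hne : j ≠ Fin.last n := fun hj' => by rw [hj', Fin.val_last] at hj; omega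
    have hs' : s = finProdFinEquiv (j + 1, (0 : Fin 2)) := by
      apply Fin.ext
      rw [hval] at hs ⊢
      simp only [Fin.isValue, Fin.val_one, Fin.val_zero, zero_add, Fin.val_add_one, hne,
        if_false] at hs ⊢
      omega
    subst hs'
    have hodd : ¬ (((1 : Fin 2) : ℕ) + 2 * (j : ℕ)) % 2 = 0 := by simp
    simp only [walkAdj, hval, hodd, if_false, pairSeq_apply_zero, pairSeq_apply_one]
    exact (h j).2.symm

/-! ### Sequences without singletons -/

omit [Fintype Λ] in
/-- Every label occurs at least twice. [Allen–O'Donnell–Witmer 2015, App. A.4] [folklore] -/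
def NoSingleton {N : ℕ} (W : Fin N → Λ) : Prop := ∀ t, ∃ s, s ≠ t ∧ W s = W t

omit [Fintype Λ] in
/-- `NoSingleton` is decidable. [folklore] -/
instance instDecidableNoSingleton {N : ℕ} (W : Fin N → Λ) : Decidable (NoSingleton W) := by
  unfold NoSingleton
  infer_instance

omit [Fintype Λ] in
/-- A sequence with a singleton has a label of multiplicity one. [folklore] -/
theorem exists_labelCount_eq_one {N : ℕ} {W : Fin N → Λ} (h : ¬ NoSingleton W) :
    ∃ i, labelCount W i = 1 := by
  simp only [NoSingleton, not_forall, not_exists, not_and] at h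
  obtain ⟨t, ht⟩ := h
  refine ⟨W t, ?_⟩
  rw [labelCount, Finset.card_eq_one]
  refine ⟨t, ?_⟩
  ext s
  simp only [Finset.mem_filter, Finset.mem_univ, true_and, Finset.mem_singleton]
  exact ⟨fun hs => by_contra fun hst => ht s hst hs, fun hs => by rw [hs]⟩

/-- **The expectation of a label product** is at most `p^{#distinct labels}` if every label occurs
twice, and `0` otherwise. [Allen–O'Donnell–Witmer 2015, App. A.4] [cite: arXiv150504383, App. A] -/
theorem abs_subsetExp_prod_seq_le {p : ℝ} (hp0 : 0 ≤ p) (hp1 : p ≤ 1) {N : ℕ} (W : Fin N → Λ) :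
    |subsetExp Λ p (fun T => ∏ t, (ind T (W t) - p))| ≤
      if NoSingleton W then p ^ numLabels W else 0 := by
  split_ifs with h
  · exact abs_subsetExp_prod_centred_seq_le hp0 hp1 W
  · obtain ⟨i, hi⟩ := exists_labelCount_eq_one h
    rw [subsetExp_prod_centred_seq_eq_zero hp0 hp1 W hi, abs_zero]

/-! ### The random fiber matrix and its moment bound -/

/-- **The random signed fiber matrix** `B_T(u,v) = ∑_{ℓ over (u,v)} ε_ℓ (1[ℓ ∈ T] - p)`.
[Allen–O'Donnell–Witmer 2015, App. A.1 (`B_{U₁,U₂} = w(U₁,U₂)`, `w` centred)] [cite: arXiv150504383, App. A] -/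
def randFiberMatrix (row : Λ → U) (col : Λ → V) (ε : Λ → ℝ) (p : ℝ) (T : Finset Λ) : Matrix U V ℝ :=
  fiberMatrix row col fun l => ε l * (ind T l - p)

omit [DecidableEq Λ] in
/-- An `if` independent of the sample commutes with the expectation. [folklore] -/
theorem subsetExp_ite (p : ℝ) (c : Prop) [Decidable c] (f : Finset Λ → ℝ) :
    subsetExp Λ p (fun T => if c then f T else 0) = if c then subsetExp Λ p f else 0 := by
  split_ifs <;> simp [subsetExp]

omit [Fintype Λ] [DecidableEq Λ] in
/-- Signs have product of absolute value at most one. [folklore] -/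
theorem abs_prod_mul_le_one {n : ℕ} (ε : Λ → ℝ) (hε : ∀ l, |ε l| ≤ 1) (L L' : Fin (n + 1) → Λ) :
    |∏ j, ε (L j) * ε (L' j)| ≤ 1 := by
  rw [Finset.abs_prod]
  refine Finset.prod_le_one (fun j _ => abs_nonneg _) fun j _ => ?_
  rw [abs_mul]
  exact mul_le_one₀ (hε _) (abs_nonneg _) (hε _)

/-- Powers of `pD` below the top one are dominated by `max 1 ((pD)^n)`. [folklore] -/
theorem pow_le_max_one_pow {x : ℝ} (hx : 0 ≤ x) {d n : ℕ} (hd : d ≤ n) : x ^ d ≤ max 1 (x ^ n) := by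
  rcases le_or_gt x 1 with h1 | h1
  · exact (pow_le_one₀ hx h1).trans (le_max_left _ _)
  · exact (pow_le_pow_right₀ h1.le hd).trans (le_max_right _ _)

/-- **The moment bound** (trace method for random signed fiber matrices): with the neighbour
bound `D` on rows and columns, `|ε| ≤ 1`, `0 ≤ p ≤ 1` and `q = n+1`,
`E tr((B_TᵀB_T)^q) ≤ |Λ| (2q)^{2q-1} p · q · max(1, (pD)^{q-1})` (with `2q` written `q·2`).
[Allen–O'Donnell–Witmer 2015, App. A.1 and A.4 (trace method); Füredi–Komlós 1981, §3] [cite: arXiv150504383, App. A] -/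
theorem subsetExp_trace_pow_randFiberMatrix_le (row : Λ → U) (col : Λ → V) (ε : Λ → ℝ)
    (hε : ∀ l, |ε l| ≤ 1) {D : ℕ} (hrow : ∀ l, (univ.filter fun l' => row l' = row l).card ≤ D)
    (hcol : ∀ l, (univ.filter fun l' => col l' = col l).card ≤ D) {p : ℝ} (hp0 : 0 ≤ p)
    (hp1 : p ≤ 1) (n : ℕ) :
    subsetExp Λ p (fun T =>
        (((randFiberMatrix row col ε p T)ᵀ * randFiberMatrix row col ε p T) ^ (n + 1)).trace) ≤
      Fintype.card Λ * (((n + 1) * 2 : ℕ) : ℝ) ^ ((n + 1) * 2 - 1) * p *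
        ((n + 1) * max 1 ((p * D) ^ n)) := by
  -- Step 1: label expansion under the expectation
  have hexp : subsetExp Λ p (fun T =>
      (((randFiberMatrix row col ε p T)ᵀ * randFiberMatrix row col ε p T) ^ (n + 1)).trace) =
      ∑ L : Fin (n + 1) → Λ, ∑ L' : Fin (n + 1) → Λ,
        if IsAdmissible row col L L' then
          (∏ j, ε (L j) * ε (L' j)) *
            subsetExp Λ p (fun T => ∏ t, (ind T (pairSeq L L' t) - p))
        else 0 := by
    unfold randFiberMatrix
    simp only [trace_pow_fiberMatrix]
    rw [subsetExp_sum]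
    refine Finset.sum_congr rfl fun L _ => ?_
    rw [subsetExp_sum]
    refine Finset.sum_congr rfl fun L' _ => ?_
    rw [subsetExp_ite]
    split_ifs
    · rw [← subsetExp_const_mul]
      congr 1
      funext T
      rw [prod_pairSeq L L' (fun x => ind T x - p), ← Finset.prod_mul_distrib]
      exact Finset.prod_congr rfl fun j _ => by ring
    · rfl
  rw [hexp]
  -- Step 2: bound each term and pass to interleaved sequences
  set f : (Fin ((n + 1) * 2) → Λ) → ℝ := fun W => if NoSingleton W then p ^ numLabels W else 0
    with hf
  have hf0 : ∀ W, 0 ≤ f W := fun W => by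
    simp only [hf]
    split_ifs
    · positivity
    · rfl
  have hterm : ∀ L L' : Fin (n + 1) → Λ,
      (if IsAdmissible row col L L' then
          (∏ j, ε (L j) * ε (L' j)) * subsetExp Λ p (fun T => ∏ t, (ind T (pairSeq L L' t) - p))
        else 0) ≤
        if IsAdmissible row col L L' then f (pairSeq L L') else 0 := by
    intro L L'
    split_ifs with hadm
    · refine (le_abs_self _).trans ?_
      rw [abs_mul]
      refine (mul_le_of_le_one_left (abs_nonneg _) (abs_prod_mul_le_one ε hε L L')).trans ?_
      exact abs_subsetExp_prod_seq_le hp0 hp1 _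
    · rfl
  have hstep2 : ∑ L : Fin (n + 1) → Λ, ∑ L' : Fin (n + 1) → Λ,
      (if IsAdmissible row col L L' then
          (∏ j, ε (L j) * ε (L' j)) * subsetExp Λ p (fun T => ∏ t, (ind T (pairSeq L L' t) - p))
        else 0) ≤
      ∑ W ∈ univ.filter (IsAdjSeq (walkAdj row col)), f W := by
    calc _ ≤ ∑ L : Fin (n + 1) → Λ, ∑ L' : Fin (n + 1) → Λ,
          (if IsAdmissible row col L L' then f (pairSeq L L') else 0) :=
          Finset.sum_le_sum fun L _ => Finset.sum_le_sum fun L' _ => hterm L L'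
      _ = ∑ LL ∈ (univ : Finset ((Fin (n + 1) → Λ) × (Fin (n + 1) → Λ))).filter
            (fun LL => IsAdmissible row col LL.1 LL.2), f (pairSeq LL.1 LL.2) := by
          rw [Finset.sum_filter, ← Finset.univ_product_univ, Finset.sum_product]
      _ = ∑ W ∈ ((univ : Finset ((Fin (n + 1) → Λ) × (Fin (n + 1) → Λ))).filter
            (fun LL => IsAdmissible row col LL.1 LL.2)).image (fun LL => pairSeq LL.1 LL.2), f W := by
          rw [Finset.sum_image fun x _ y _ h => pairSeq_injective h]
      _ ≤ ∑ W ∈ univ.filter (IsAdjSeq (walkAdj row col)), f W := by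
          refine Finset.sum_le_sum_of_subset_of_nonneg ?_ fun W _ _ => hf0 W
          intro W hW
          obtain ⟨LL, hLL, rfl⟩ := Finset.mem_image.1 hW
          exact Finset.mem_filter.2 ⟨Finset.mem_univ _,
            isAdjSeq_pairSeq row col (Finset.mem_filter.1 hLL).2⟩
  refine hstep2.trans ?_
  -- Step 3: group by the number of distinct labels
  have hfle : ∀ W : Fin ((n + 1) * 2) → Λ, f W ≤
      ∑ d ∈ Finset.Icc 1 (n + 1), if numLabels W = d then p ^ d else 0 := by
    intro W
    simp only [hf]
    split_ifs with hns
    · have hle : numLabels W ≤ n + 1 := by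
        have := two_mul_numLabels_le W hns
        omega
      have hpos : 1 ≤ numLabels W :=
        Finset.card_pos.2 ⟨W ⟨0, by positivity⟩, Finset.mem_image_of_mem _ (Finset.mem_univ _)⟩
      rw [Finset.sum_ite_eq_of_mem _ _ _ (Finset.mem_Icc.2 ⟨hpos, hle⟩)]
    · exact Finset.sum_nonneg fun d _ => by split_ifs <;> positivity
  have hstep3 : ∑ W ∈ univ.filter (IsAdjSeq (walkAdj row col)), f W ≤
      ∑ d ∈ Finset.Icc 1 (n + 1), p ^ d * (adjSeqs (walkAdj row col) ((n + 1) * 2) d).card := by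
    calc _ ≤ ∑ W ∈ univ.filter (IsAdjSeq (walkAdj row col)),
          ∑ d ∈ Finset.Icc 1 (n + 1), (if numLabels W = d then p ^ d else 0) :=
          Finset.sum_le_sum fun W _ => hfle W
      _ = ∑ d ∈ Finset.Icc 1 (n + 1), ∑ W ∈ univ.filter (IsAdjSeq (walkAdj row col)),
          (if numLabels W = d then p ^ d else 0) := Finset.sum_comm
      _ = _ := by
          refine Finset.sum_congr rfl fun d _ => ?_
          rw [← Finset.sum_filter, Finset.sum_const, nsmul_eq_mul, mul_comm]
          congr 2
          simp only [adjSeqs, Finset.filter_filter]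
  refine hstep3.trans ?_
  -- Step 4: the count, and summation of the geometric-type series
  have hN : 0 < (n + 1) * 2 := by positivity
  have hcount : ∀ d ∈ Finset.Icc 1 (n + 1),
      p ^ d * ((adjSeqs (walkAdj row col) ((n + 1) * 2) d).card : ℝ) ≤
        Fintype.card Λ * (((n + 1) * 2 : ℕ) : ℝ) ^ ((n + 1) * 2 - 1) * (p * max 1 ((p * D) ^ n)) := by
    intro d hd
    obtain ⟨hd1, hdn⟩ := Finset.mem_Icc.1 hd
    have hc := card_adjSeqs_le' (walkAdj row col) (card_filter_walkAdj_le row col hrow hcol) hN hd1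
    have hc' : ((adjSeqs (walkAdj row col) ((n + 1) * 2) d).card : ℝ) ≤
        Fintype.card Λ * (((n + 1) * 2 : ℕ) : ℝ) ^ ((n + 1) * 2 - 1) * (D : ℝ) ^ (d - 1) := by
      exact_mod_cast hc
    have hpd : p ^ d * (D : ℝ) ^ (d - 1) ≤ p * max 1 ((p * D) ^ n) := by
      obtain ⟨d', rfl⟩ := Nat.exists_eq_add_of_le hd1
      rw [show 1 + d' - 1 = d' from by omega, pow_add, pow_one, mul_assoc, ← mul_pow]
      exact mul_le_mul_of_nonneg_left (pow_le_max_one_pow (by positivity) (by omega)) hp0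
    calc p ^ d * ((adjSeqs (walkAdj row col) ((n + 1) * 2) d).card : ℝ)
        ≤ p ^ d * (Fintype.card Λ * (((n + 1) * 2 : ℕ) : ℝ) ^ ((n + 1) * 2 - 1) * (D : ℝ) ^ (d - 1)) :=
          mul_le_mul_of_nonneg_left hc' (by positivity)
      _ = Fintype.card Λ * (((n + 1) * 2 : ℕ) : ℝ) ^ ((n + 1) * 2 - 1) * (p ^ d * (D : ℝ) ^ (d - 1)) := by
          ring
      _ ≤ _ := mul_le_mul_of_nonneg_left hpd (by positivity)
  calc ∑ d ∈ Finset.Icc 1 (n + 1), p ^ d * ((adjSeqs (walkAdj row col) ((n + 1) * 2) d).card : ℝ)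
      ≤ ∑ _d ∈ Finset.Icc 1 (n + 1),
          Fintype.card Λ * (((n + 1) * 2 : ℕ) : ℝ) ^ ((n + 1) * 2 - 1) * (p * max 1 ((p * D) ^ n)) :=
        Finset.sum_le_sum hcount
    _ = _ := by
        rw [Finset.sum_const, Nat.card_Icc, nsmul_eq_mul]
        push_cast
        ring

end Literature.Computability.Complexity
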